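import Summits.CriticalPhenomena.PercolationContinuityZ3.Theorems.PercNearOneGluingNoHeavyLowerTailKnQuestion8CoefficientwiseTrivialCoreFlip
import HarnessLib

/-!
# Component flips are symmetries of the wall for EVERY colouring: the zone of the conditioning vertex splits all of `T` into cubes

Support file (`--supports stmt-CriticalPhenomena-4575`, closed), prover `prim-cplus-coupling` (gen 29).  No definitions, no named facts, no sorries;
standard axioms.  Memo `prim-cplus-coupling/A5-COUPLING-gen29.md` §2 (general orbit decomposition).

Setting (prim-lf-2's `Coefficientwise` files, root written `z` here): finite multigraph `ends : ι → Sym2 V`, edge set `E₀`, colouring `s ⊆ E₀` (red) /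
`E₀ \ s` (blue), `C_v(s) = openCluster (ends '' s) v`, zone `U = C_z(s) ∪ C_z(E₀ \ s)`.  prim-lf-2's FLIP LEMMA (`mem_openCluster_flip_iff`,
…CoefficientwiseComponentFlip) computes the red cluster of `z` after recolouring all edges at a union `W` of components of `U \ {z}` UNDER THE HYPOTHESIS
that the two clusters of `z` meet only in `z` (CC / trivial core).  This file removes that hypothesis:
* `Coefficientwise.mem_openCluster_flip_iff_general` — for ANY `s ⊆ E₀` and any `W ⊆ U \ {z}` closed under the `E₀`-edges inside `U \ {z}`,
  with `I` = the edges of `E₀` meeting `W`:  `C_z(s ∆ I) = {z} ∪ (C_z(s) \ W) ∪ (W ∩ C_z(E₀ \ s))` — inside `W` the two clusters of `z` are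
  EXCHANGED (core vertices of `W` stay core vertices), outside `W` nothing changes;
* `Coefficientwise.mem_openCluster_sdiff_flip_iff_general` — the same for the blue cluster;
* `Coefficientwise.union_flip_eq_general` — hence the zone is invariant, `U(s ∆ I) = U(s)`, and so are the wall `x ∉ U` ('no monochromatic `x–z` path'),
  the components and the free edges.
Consequence (memo §2): the wall event `T` of EVERY instance is a disjoint union of classes `≅ 2^{components of U∖{z}} × 2^{free edges}` on which the
colour swap is the antipode; on the classes all of whose components are one-sided the cluster quadruple is grand-monotone (THEOREM TC,
…CoefficientwiseTrivialCore); the classes with a two-sided component (one containing a vertex `≠ z` of the bichromatic core of `z`) carry all the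
negative mass of conjecture GRAND (exact census n ≤ 6: 39,480 negative class sums among 6.64·10⁶ with one two-sided component, 0 among the one-sided ones).
Proofs: two applications of the closed-set principle `openCluster_subset_of_closed` (…CoefficientwiseTrivialCoreFlip) in each direction.
[cite: KozmaNitzan2024, Questions 8–9 (§5.5 p. 36) (context: the Question-8 pocket covariance programme)]
-/

namespace Summit.CriticalPhenomena.PercolationContinuityZ3.Theorems

open Finset Literature.Probability.Percolation
open scoped symmDiff

namespace Coefficientwise

variable {ι V : Type*}

open Classical in
/-- **General flip lemma.**  `s ⊆ E₀`; `W` a set of vertices of the zone `U = C_z(s) ∪ C_z(E₀ \ s)` other than `z`, closed under the `E₀`-edges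
inside `U \ {z}`; `I` the edges of `E₀` meeting `W`.  Then `y ∈ C_z(s ∆ I) ↔ y = z ∨ (y ∈ C_z(s) ∧ y ∉ W) ∨ (y ∈ W ∧ y ∈ C_z(E₀ \ s))`
— no trivial-core hypothesis. [cite: KozmaNitzan2024, §5.5 (context only; folklore)] -/
theorem mem_openCluster_flip_iff_general (ends : ι → Sym2 V) {E₀ s : Finset ι} {z : V} (hs : s ⊆ E₀) (W : Set V)
    (hWU : ∀ w ∈ W, (w ∈ openCluster (ends '' (↑s : Set ι)) z ∨ w ∈ openCluster (ends '' (↑(E₀ \ s) : Set ι)) z) ∧ w ≠ z)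
    (hWc : ∀ w ∈ W, ∀ i ∈ E₀, ∀ w', ends i = s(w, w') →
      (w' ∈ openCluster (ends '' (↑s : Set ι)) z ∨ w' ∈ openCluster (ends '' (↑(E₀ \ s) : Set ι)) z) → w' ≠ z → w' ∈ W)
    (y : V) :
    y ∈ openCluster (ends '' (↑(s ∆ (E₀.filter (fun i => ∃ w, w ∈ W ∧ w ∈ ends i))) : Set ι)) z ↔
      y = z ∨ (y ∈ openCluster (ends '' (↑s : Set ι)) z ∧ y ∉ W) ∨ (y ∈ W ∧ y ∈ openCluster (ends '' (↑(E₀ \ s) : Set ι)) z) := by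
  set A : Set V := openCluster (ends '' (↑s : Set ι)) z with hA
  set B : Set V := openCluster (ends '' (↑(E₀ \ s) : Set ι)) z with hB
  set I : Finset ι := E₀.filter (fun i => ∃ w, w ∈ W ∧ w ∈ ends i) with hI
  have memI : ∀ {i : ι}, i ∈ I ↔ i ∈ E₀ ∧ ∃ w, w ∈ W ∧ w ∈ ends i := fun {i} => by rw [hI, Finset.mem_filter]
  have hzW : z ∉ W := fun h => (hWU z h).2 rfl
  -- closure of `W` in the two directions we need
  have closeA : ∀ {a b : V} {i : ι}, i ∈ s → ends i = s(a, b) → a ∈ A → a ∈ W → b ∉ W → b = z := by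
    intro a b i hi he haA haW hbW
    by_contra hbz
    have hbA : b ∈ A := mem_openCluster_of_edge ends hi he haA
    exact hbW (hWc a haW i (hs hi) b he (Or.inl hbA) hbz)
  have closeB : ∀ {a b : V} {i : ι}, i ∈ E₀ \ s → ends i = s(a, b) → a ∈ B → a ∈ W → b ∉ W → b = z := by
    intro a b i hi he haB haW hbW
    by_contra hbz
    have hbB : b ∈ B := mem_openCluster_of_edge ends hi he haB
    exact hbW (hWc a haW i (Finset.mem_sdiff.mp hi).1 b he (Or.inr hbB) hbz)
  constructor
  · -- `⊆`: the right-hand side contains `z` and is closed under the edges of `s ∆ I`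
    intro hy
    have key : openCluster (ends '' (↑(s ∆ I) : Set ι)) z ⊆ {v | v = z ∨ (v ∈ A ∧ v ∉ W) ∨ (v ∈ W ∧ v ∈ B)} := by
      refine openCluster_subset_of_closed ends (s ∆ I) z (Or.inl rfl) ?_
      intro i hi a b he ha
      have hbi : b ∈ ends i := by rw [he]; exact Sym2.mem_mk_right a b
      have hai : a ∈ ends i := by rw [he]; exact Sym2.mem_mk_left a b
      rcases Finset.mem_symmDiff.mp hi with ⟨his, hiI⟩ | ⟨hiI, hins⟩
      · -- red edge not meeting `W`
        have haW : a ∉ W := fun h => hiI (memI.mpr ⟨hs his, a, h, hai⟩)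
        have hbW : b ∉ W := fun h => hiI (memI.mpr ⟨hs his, b, h, hbi⟩)
        have haA : a ∈ A := by
          rcases ha with rfl | ⟨haA, -⟩ | ⟨haW', -⟩
          · exact mem_openCluster_self _ _
          · exact haA
          · exact absurd haW' haW
        exact Or.inr (Or.inl ⟨mem_openCluster_of_edge ends his he haA, hbW⟩)
      · -- blue edge meeting `W`
        obtain ⟨hiE, w, hwW, hwi⟩ := memI.mp hiI
        have hib : i ∈ E₀ \ s := Finset.mem_sdiff.mpr ⟨hiE, hins⟩
        rcases ha with rfl | ⟨haA, haW⟩ | ⟨haW, haB⟩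
        · -- `a = z`: the `W`-end is `b`, which is blue-adjacent to `z`
          have hwb : w = b := by
            rw [he, Sym2.mem_iff] at hwi
            rcases hwi with rfl | rfl
            · exact absurd hwW hzW
            · rfl
          subst hwb
          exact Or.inr (Or.inr ⟨hwW, mem_openCluster_of_edge ends hib he (mem_openCluster_self _ _)⟩)
        · -- `a ∈ A \ W`: then `w = b ∈ W` is joined to `a ∈ U \ {z}` … unless `a = z`
          by_cases haz : a = z
          · subst haz
            have hwb : w = b := by
              rw [he, Sym2.mem_iff] at hwi
              rcases hwi with rfl | rfl
              · exact absurd hwW hzW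
              · rfl
            subst hwb
            exact Or.inr (Or.inr ⟨hwW, mem_openCluster_of_edge ends hib he (mem_openCluster_self _ _)⟩)
          · have hwb : w = b := by
              rw [he, Sym2.mem_iff] at hwi
              rcases hwi with rfl | rfl
              · exact absurd hwW haW
              · rfl
            subst hwb
            exact absurd (hWc w hwW i hiE a (he.trans Sym2.eq_swap) (Or.inl haA) haz) haW
        · -- `a ∈ W ∩ B`: `b` is blue-adjacent to `a`, so `b ∈ B`; `b ∈ W` or `b = z`
          have hbB : b ∈ B := mem_openCluster_of_edge ends hib he haB
          by_cases hbW : b ∈ W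
          · exact Or.inr (Or.inr ⟨hbW, hbB⟩)
          · exact Or.inl (closeB hib he haB haW hbW)
    exact key hy
  · -- `⊇`
    rintro (rfl | ⟨hyA, hyW⟩ | ⟨hyW, hyB⟩)
    · exact mem_openCluster_self _ _
    · -- `A ⊆ C_z(s \ I) ∪ (W ∩ A)`, and `s \ I ⊆ s ∆ I`
      have hsub : A ⊆ openCluster (ends '' (↑(s \ I) : Set ι)) z ∪ (W ∩ A) := by
        refine openCluster_subset_of_closed ends s z (Or.inl (mem_openCluster_self _ _)) ?_
        intro i hi a b he ha
        have hbi : b ∈ ends i := by rw [he]; exact Sym2.mem_mk_right a b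
        have hai : a ∈ ends i := by rw [he]; exact Sym2.mem_mk_left a b
        have haA : a ∈ A := by
          rcases ha with ha | ⟨-, ha⟩
          · exact openCluster_image_mono ends Finset.sdiff_subset z ha
          · exact ha
        have hbA : b ∈ A := mem_openCluster_of_edge ends hi he haA
        by_cases hbW : b ∈ W
        · exact Or.inr ⟨hbW, hbA⟩
        · rcases ha with ha | ⟨haW, -⟩
          · by_cases hiI : i ∈ I
            · -- `i` meets `W`, at `a` (since `b ∉ W`): then `b = z`
              obtain ⟨-, w, hwW, hwi⟩ := memI.mp hiI
              have hwa : w = a := by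
                rw [he, Sym2.mem_iff] at hwi
                rcases hwi with rfl | rfl
                · rfl
                · exact absurd hwW hbW
              subst hwa
              have hbz : b = z := closeA hi he haA hwW hbW
              subst hbz
              exact Or.inl (mem_openCluster_self _ _)
            · exact Or.inl (mem_openCluster_of_edge ends (Finset.mem_sdiff.mpr ⟨hi, hiI⟩) he ha)
          · have hbz : b = z := closeA hi he haA haW hbW
            subst hbz
            exact Or.inl (mem_openCluster_self _ _)
      rcases hsub hyA with h | ⟨hyW', -⟩
      · refine openCluster_image_mono ends ?_ z h
        intro i hi
        rw [Finset.mem_sdiff] at hi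
        exact Finset.mem_symmDiff.mpr (Or.inl hi)
      · exact absurd hyW' hyW
    · -- `B ⊆ C_z((E₀ \ s) ∩ I) ∪ (B \ W)`, and `(E₀ \ s) ∩ I ⊆ s ∆ I`
      have hsub : B ⊆ openCluster (ends '' (↑((E₀ \ s) ∩ I) : Set ι)) z ∪ (B \ W) := by
        refine openCluster_subset_of_closed ends (E₀ \ s) z (Or.inl (mem_openCluster_self _ _)) ?_
        intro i hi a b he ha
        have hbi : b ∈ ends i := by rw [he]; exact Sym2.mem_mk_right a b
        have haB : a ∈ B := by
          rcases ha with ha | ⟨ha, -⟩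
          · exact openCluster_image_mono ends Finset.inter_subset_left z ha
          · exact ha
        have hbB : b ∈ B := mem_openCluster_of_edge ends hi he haB
        by_cases hbW : b ∈ W
        · have hiI : i ∈ I := memI.mpr ⟨(Finset.mem_sdiff.mp hi).1, b, hbW, hbi⟩
          rcases ha with ha | ⟨-, haW⟩
          · exact Or.inl (mem_openCluster_of_edge ends (Finset.mem_inter.mpr ⟨hi, hiI⟩) he ha)
          · by_cases haz : a = z
            · subst haz
              exact Or.inl (mem_openCluster_of_edge ends (Finset.mem_inter.mpr ⟨hi, hiI⟩) he (mem_openCluster_self _ _))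
            · exact absurd (hWc b hbW i (Finset.mem_sdiff.mp hi).1 a (he.trans Sym2.eq_swap) (Or.inr haB) haz) haW
        · exact Or.inr ⟨hbB, hbW⟩
      rcases hsub hyB with h | ⟨-, hyW'⟩
      · refine openCluster_image_mono ends ?_ z h
        intro i hi
        rw [Finset.mem_inter, Finset.mem_sdiff] at hi
        exact Finset.mem_symmDiff.mpr (Or.inr ⟨hi.2, hi.1.2⟩)
      · exact absurd hyW hyW'

open Classical in
/-- The blue cluster of `z` after the flip: `y ∈ C_z(E₀ \ (s ∆ I)) ↔ y = z ∨ (y ∈ C_z(E₀ \ s) ∧ y ∉ W) ∨ (y ∈ W ∧ y ∈ C_z(s))` (general flip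
lemma applied to the complementary colouring). [cite: KozmaNitzan2024, §5.5 (context only; folklore)] -/
theorem mem_openCluster_sdiff_flip_iff_general (ends : ι → Sym2 V) {E₀ s : Finset ι} {z : V} (hs : s ⊆ E₀) (W : Set V)
    (hWU : ∀ w ∈ W, (w ∈ openCluster (ends '' (↑s : Set ι)) z ∨ w ∈ openCluster (ends '' (↑(E₀ \ s) : Set ι)) z) ∧ w ≠ z)
    (hWc : ∀ w ∈ W, ∀ i ∈ E₀, ∀ w', ends i = s(w, w') →
      (w' ∈ openCluster (ends '' (↑s : Set ι)) z ∨ w' ∈ openCluster (ends '' (↑(E₀ \ s) : Set ι)) z) → w' ≠ z → w' ∈ W)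
    (y : V) :
    y ∈ openCluster (ends '' (↑(E₀ \ (s ∆ (E₀.filter (fun i => ∃ w, w ∈ W ∧ w ∈ ends i)))) : Set ι)) z ↔
      y = z ∨ (y ∈ openCluster (ends '' (↑(E₀ \ s) : Set ι)) z ∧ y ∉ W) ∨ (y ∈ W ∧ y ∈ openCluster (ends '' (↑s : Set ι)) z) := by
  have hIE : E₀.filter (fun i => ∃ w, w ∈ W ∧ w ∈ ends i) ⊆ E₀ := Finset.filter_subset _ _
  rw [sdiff_symmDiff_eq E₀ s _ hIE]
  have hss : E₀ \ (E₀ \ s) = s := Finset.sdiff_sdiff_eq_self hs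
  have h := mem_openCluster_flip_iff_general ends (E₀ := E₀) (s := E₀ \ s) (z := z) Finset.sdiff_subset W
    (fun w hw => ⟨by rw [hss]; exact (hWU w hw).1.symm, (hWU w hw).2⟩)
    (fun w hw i hi w' he hw' hne => hWc w hw i hi w' he (by rw [hss] at hw'; exact hw'.symm) hne) y
  rw [hss] at h
  exact h

open Classical in
/-- **The zone is invariant under component flips, for every colouring.**  Under the hypotheses of the general flip lemma,
`C_z(s ∆ I) ∪ C_z(E₀ \ (s ∆ I)) = C_z(s) ∪ C_z(E₀ \ s)`; in particular the wall `x ∉ zone` is preserved. [cite: KozmaNitzan2024, §5.5 (context only)] -/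
theorem union_flip_eq_general (ends : ι → Sym2 V) {E₀ s : Finset ι} {z : V} (hs : s ⊆ E₀) (W : Set V)
    (hWU : ∀ w ∈ W, (w ∈ openCluster (ends '' (↑s : Set ι)) z ∨ w ∈ openCluster (ends '' (↑(E₀ \ s) : Set ι)) z) ∧ w ≠ z)
    (hWc : ∀ w ∈ W, ∀ i ∈ E₀, ∀ w', ends i = s(w, w') →
      (w' ∈ openCluster (ends '' (↑s : Set ι)) z ∨ w' ∈ openCluster (ends '' (↑(E₀ \ s) : Set ι)) z) → w' ≠ z → w' ∈ W) :
    openCluster (ends '' (↑(s ∆ (E₀.filter (fun i => ∃ w, w ∈ W ∧ w ∈ ends i))) : Set ι)) z ∪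
      openCluster (ends '' (↑(E₀ \ (s ∆ (E₀.filter (fun i => ∃ w, w ∈ W ∧ w ∈ ends i)))) : Set ι)) z =
    openCluster (ends '' (↑s : Set ι)) z ∪ openCluster (ends '' (↑(E₀ \ s) : Set ι)) z := by
  ext y
  simp only [Set.mem_union]
  rw [mem_openCluster_flip_iff_general ends hs W hWU hWc y, mem_openCluster_sdiff_flip_iff_general ends hs W hWU hWc y]
  constructor
  · rintro ((rfl | ⟨h, -⟩ | ⟨-, h⟩) | (rfl | ⟨h, -⟩ | ⟨-, h⟩))
    · exact Or.inl (mem_openCluster_self _ _)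
    · exact Or.inl h
    · exact Or.inr h
    · exact Or.inl (mem_openCluster_self _ _)
    · exact Or.inr h
    · exact Or.inl h
  · rintro (h | h)
    · by_cases hyW : y ∈ W
      · exact Or.inr (Or.inr (Or.inr ⟨hyW, h⟩))
      · exact Or.inl (Or.inr (Or.inl ⟨h, hyW⟩))
    · by_cases hyW : y ∈ W
      · exact Or.inl (Or.inr (Or.inr ⟨hyW, h⟩))
      · exact Or.inr (Or.inr (Or.inl ⟨h, hyW⟩))

end Coefficientwise

end Summit.CriticalPhenomena.PercolationContinuityZ3.Theorems
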